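import Literature.Probability.Process.StableLikeJumpChain
import Literature.Probability.Process.StableLikeJumpChainKernel
import Literature.Probability.Process.StableLikeJumpChainLattice
import HarnessLib

/-!
# Stable-like conductances on `ℤ^d`: the one-step kernel

Support file for the proof of Bass–Levin 2002, Theorem 1.1
(`Literature.Probability.Process.bassLevin_thm_1_1`). From conductances `C` satisfying the
hypotheses of the theorem (zero diagonal, symmetry, summable rows, and the comparability
`κ⁻¹ ‖x−y‖^{-(d+α)} ≤ C x y ≤ κ ‖x−y‖^{-(d+α)}`, Bass–Levin eq. (1.2)) we derive the standing
properties of the one-step kernel `P x y = C x y / ∑_w C x w` (eq. (1.1)/(2.1)) used by the rest of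
the proof, packaged as an existential statement (`exists_kernel_package`):

* the normalising weights `μ x = ∑_w C x w` are bounded above and below by positive constants
  (Bass–Levin p. 2935: "`c₁⁻¹ ≤ C_x / C_y ≤ c₁`"),
* `P` is a Markov kernel, reversible with respect to `μ` (`μ x P x y = C x y` is symmetric),
* two-sided bounds `c₁ ‖x−y‖^{-(d+α)} ≤ P x y ≤ c₂ ‖x−y‖^{-(d+α)}` (for all `x, y`, with the
  convention `0^{-(d+α)} = 0` of `Real.rpow`, consistent with `P x x = 0`).

We also record that `jumpChainProb C` satisfies the kernel-power recursion of
`StableLikeJumpChainKernel` with this kernel. No new definitions are introduced.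

## References
* R. F. Bass, D. A. Levin, *Transition probabilities for symmetric jump processes*,
  Trans. Amer. Math. Soc. 354 (2002) 2933–2953, §1 (1.1)–(1.2), §2 (2.1), p. 2935.
-/

noncomputable section

namespace Literature.Probability.Process

open scoped BigOperators

variable {d : ℕ}

/-- `jumpChainProb C` at time `0` is the identity kernel. [cite: BassLevin2002, §1 eq. (1.1)] -/
theorem jumpChainProb_zero (C : (Fin d → ℤ) → (Fin d → ℤ) → ℝ) (x y : Fin d → ℤ) :
    jumpChainProb C 0 x y = if x = y then 1 else 0 := rfl

/-- `jumpChainProb C` satisfies the right Chapman–Kolmogorov recursion with the one-step kernel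
`z y ↦ C z y / ∑_w C z w`. [cite: BassLevin2002, §1 eq. (1.1)] -/
theorem jumpChainProb_succ (C : (Fin d → ℤ) → (Fin d → ℤ) → ℝ) (n : ℕ) (x y : Fin d → ℤ) :
    jumpChainProb C (n + 1) x y =
      ∑' z, jumpChainProb C n x z * (C z y / ∑' w, C z w) := rfl

/-- The sup norm of the coordinate vector `eᵢ ∈ ℤ^d` is `1`. [folklore] -/
theorem norm_single_one (i : Fin d) : ‖(Pi.single i (1 : ℤ) : Fin d → ℤ)‖ = 1 := by
  rw [Pi.norm_single]
  simp

/-- Under the stable-like bounds the conductances are nonnegative. [cite: BassLevin2002, §1 eq. (1.2)] -/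
theorem conductance_nonneg {α κ : ℝ} {C : (Fin d → ℤ) → (Fin d → ℤ) → ℝ} (hκ : 1 < κ)
    (hC0 : ∀ x, C x x = 0)
    (hCb : ∀ x y, x ≠ y →
      κ⁻¹ * ‖x - y‖ ^ (-((d : ℝ) + α)) ≤ C x y ∧ C x y ≤ κ * ‖x - y‖ ^ (-((d : ℝ) + α)))
    (x y : Fin d → ℤ) : 0 ≤ C x y := by
  by_cases h : x = y
  · subst h; rw [hC0]
  · refine le_trans ?_ (hCb x y h).1
    have : 0 < κ := by linarith
    exact mul_nonneg (inv_nonneg.mpr this.le) (Real.rpow_nonneg (norm_nonneg _) _)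

/-- Two-sided bounds on the conductances valid for all pairs (with `0 ^ {-(d+α)} = 0`).
[cite: BassLevin2002, §1 eq. (1.2)] -/
theorem conductance_bounds {α κ : ℝ} {C : (Fin d → ℤ) → (Fin d → ℤ) → ℝ} (hα : 0 < α)
    (hC0 : ∀ x, C x x = 0)
    (hCb : ∀ x y, x ≠ y →
      κ⁻¹ * ‖x - y‖ ^ (-((d : ℝ) + α)) ≤ C x y ∧ C x y ≤ κ * ‖x - y‖ ^ (-((d : ℝ) + α)))
    (x y : Fin d → ℤ) :
    κ⁻¹ * ‖x - y‖ ^ (-((d : ℝ) + α)) ≤ C x y ∧ C x y ≤ κ * ‖x - y‖ ^ (-((d : ℝ) + α)) := by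
  by_cases h : x = y
  · subst h
    have hne : -((d : ℝ) + α) ≠ 0 := by
      have : (0 : ℝ) ≤ d := Nat.cast_nonneg d
      intro h0; linarith
    rw [hC0, sub_self, norm_zero, Real.zero_rpow hne, mul_zero, mul_zero]
    exact ⟨le_rfl, le_rfl⟩
  · exact hCb x y h

/-- **The kernel package.** From conductances satisfying the hypotheses of Bass–Levin Thm 1.1 we
extract: positive bounds `m ≤ μ x ≤ M` for `μ x = ∑_w C x w`, the Markov property and
reversibility of `P x y = C x y / μ x`, and two-sided stable-like bounds
`c₁ ‖x−y‖^{-(d+α)} ≤ P x y ≤ c₂ ‖x−y‖^{-(d+α)}`.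
[cite: BassLevin2002, §2 p. 2935 (eq. (2.1) and "`c₁⁻¹ ≤ C_x/C_y ≤ c₁`")] -/
theorem exists_kernel_package {α κ : ℝ} {C : (Fin d → ℤ) → (Fin d → ℤ) → ℝ}
    (hd : 1 ≤ d) (hα : 0 < α) (hκ : 1 < κ)
    (hC0 : ∀ x, C x x = 0) (hCs : ∀ x y, C x y = C y x) (hCsum : ∀ x, Summable (C x))
    (hCb : ∀ x y, x ≠ y →
      κ⁻¹ * ‖x - y‖ ^ (-((d : ℝ) + α)) ≤ C x y ∧ C x y ≤ κ * ‖x - y‖ ^ (-((d : ℝ) + α))) :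
    ∃ m M c₁ c₂ : ℝ, 0 < m ∧ m ≤ M ∧ 0 < c₁ ∧ c₁ ≤ c₂ ∧
      (∀ x, m ≤ ∑' w, C x w ∧ ∑' w, C x w ≤ M) ∧
      (∀ x y, 0 ≤ C x y / ∑' w, C x w) ∧
      (∀ x, HasSum (fun y => C x y / ∑' w, C x w) 1) ∧
      (∀ x y, (∑' w, C x w) * (C x y / ∑' w, C x w) = (∑' w, C y w) * (C y x / ∑' w, C y w)) ∧
      (∀ x y, c₁ * ‖x - y‖ ^ (-((d : ℝ) + α)) ≤ C x y / ∑' w, C x w) ∧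
      (∀ x y, C x y / ∑' w, C x w ≤ c₂ * ‖x - y‖ ^ (-((d : ℝ) + α))) := by
  have hκ0 : 0 < κ := by linarith
  have hCnn : ∀ x y, 0 ≤ C x y := conductance_nonneg hκ hC0 hCb
  have hCb' := conductance_bounds hα hC0 hCb
  set s : ℝ := (d : ℝ) + α with hs
  have hds : (d : ℝ) < s := by rw [hs]; linarith
  -- the lattice sum Z = ∑_{h ≠ 0} ‖h‖^{-s}
  obtain ⟨hZs, hZle⟩ := summable_norm_rpow_neg hd hds
  set Z : ℝ := ∑' h : Fin d → ℤ, (if h = 0 then (0 : ℝ) else ‖h‖ ^ (-s)) with hZ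
  have hZnn : 0 ≤ Z := tsum_nonneg fun h => by
    split_ifs
    · exact le_rfl
    · exact Real.rpow_nonneg (norm_nonneg _) _
  -- lower bound on μ via the nearest neighbour
  obtain ⟨i0⟩ : Nonempty (Fin d) := ⟨⟨0, hd⟩⟩
  have hμlb : ∀ x, κ⁻¹ ≤ ∑' w, C x w := by
    intro x
    set e : Fin d → ℤ := Pi.single i0 1 with he
    have hxe : x ≠ x + e := by
      intro h
      have : e = 0 := by simpa using h.symm
      have hn := norm_single_one i0
      rw [← he, this, norm_zero] at hn
      exact zero_ne_one hn
    have h1 : κ⁻¹ * ‖x - (x + e)‖ ^ (-s) = κ⁻¹ := by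
      have : ‖x - (x + e)‖ = 1 := by
        rw [sub_add_cancel_left, norm_neg, he, norm_single_one]
      rw [this, Real.one_rpow, mul_one]
    calc κ⁻¹ = κ⁻¹ * ‖x - (x + e)‖ ^ (-s) := h1.symm
      _ ≤ C x (x + e) := (hCb x (x + e) hxe).1
      _ ≤ ∑' w, C x w := (hCsum x).le_tsum (x + e) (fun w _ => hCnn x w)
  -- upper bound on μ via the lattice sum
  have hμub : ∀ x, ∑' w, C x w ≤ κ * Z := by
    intro x
    have hpt : ∀ w, C x w ≤ κ * (if w - x = 0 then (0 : ℝ) else ‖w - x‖ ^ (-s)) := by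
      intro w
      by_cases hw : w - x = 0
      · have : w = x := sub_eq_zero.mp hw
        subst this
        simp [hC0]
      · rw [if_neg hw, norm_sub_rev]
        have hxw : x ≠ w := fun h => hw (by rw [h, sub_self])
        exact (hCb x w hxw).2
    have hsum' : Summable fun w => κ * (if w - x = 0 then (0 : ℝ) else ‖w - x‖ ^ (-s)) := by
      refine (Summable.mul_left κ ?_)
      exact (Equiv.subRight x).summable_iff.mpr hZs |>.congr (fun w => rfl)
    calc ∑' w, C x w ≤ ∑' w, κ * (if w - x = 0 then (0 : ℝ) else ‖w - x‖ ^ (-s)) :=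
          Summable.tsum_le_tsum hpt (hCsum x) hsum'
      _ = κ * ∑' w, (if w - x = 0 then (0 : ℝ) else ‖w - x‖ ^ (-s)) := tsum_mul_left
      _ = κ * Z := by
          congr 1
          exact (Equiv.subRight x).tsum_eq (fun h => if h = 0 then (0 : ℝ) else ‖h‖ ^ (-s))
  have hμpos : ∀ x, 0 < ∑' w, C x w := fun x => lt_of_lt_of_le (inv_pos.mpr hκ0) (hμlb x)
  refine ⟨κ⁻¹, κ * Z, κ⁻¹ / (κ * Z), κ / κ⁻¹, inv_pos.mpr hκ0, (hμlb 0).trans (hμub 0),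
    div_pos (inv_pos.mpr hκ0) (lt_of_lt_of_le (inv_pos.mpr hκ0) ((hμlb 0).trans (hμub 0))),
    ?_, fun x => ⟨hμlb x, hμub x⟩, fun x y => div_nonneg (hCnn x y) (hμpos x).le,
    fun x => ?_, fun x y => ?_, fun x y => ?_, fun x y => ?_⟩
  · -- c₁ ≤ c₂
    have hKZ : κ⁻¹ ≤ κ * Z := (hμlb 0).trans (hμub 0)
    have h1 : κ⁻¹ / (κ * Z) ≤ 1 := by
      rw [div_le_one (lt_of_lt_of_le (inv_pos.mpr hκ0) hKZ)]; exact hKZ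
    have h2 : (1 : ℝ) ≤ κ / κ⁻¹ := by
      rw [le_div_iff₀ (inv_pos.mpr hκ0), one_mul]
      have : κ⁻¹ ≤ 1 := inv_le_one_of_one_le₀ hκ.le
      linarith
    linarith
  · -- Markov
    have h := (hCsum x).hasSum.div_const (∑' w, C x w)
    rwa [div_self (hμpos x).ne'] at h
  · -- reversibility
    rw [mul_div_cancel₀ _ (hμpos x).ne', mul_div_cancel₀ _ (hμpos y).ne', hCs]
  · -- lower kernel bound
    calc κ⁻¹ / (κ * Z) * ‖x - y‖ ^ (-((d : ℝ) + α))
        = (κ⁻¹ * ‖x - y‖ ^ (-((d : ℝ) + α))) / (κ * Z) := by ring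
      _ ≤ C x y / (κ * Z) := div_le_div_of_nonneg_right (hCb' x y).1
          (lt_of_lt_of_le (inv_pos.mpr hκ0) ((hμlb 0).trans (hμub 0))).le
      _ ≤ C x y / ∑' w, C x w :=
          div_le_div_of_nonneg_left (hCnn x y) (hμpos x) (hμub x)
  · -- upper kernel bound
    calc C x y / ∑' w, C x w ≤ C x y / κ⁻¹ :=
          div_le_div_of_nonneg_left (hCnn x y) (inv_pos.mpr hκ0) (hμlb x)
      _ ≤ (κ * ‖x - y‖ ^ (-((d : ℝ) + α))) / κ⁻¹ :=
          div_le_div_of_nonneg_right (hCb' x y).2 (inv_pos.mpr hκ0).le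
      _ = κ / κ⁻¹ * ‖x - y‖ ^ (-((d : ℝ) + α)) := by ring

end Literature.Probability.Process
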